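import Literature.Probability.Percolation.MarkedLoopLawSlide
import Literature.Probability.Percolation.TriMarkedDomainAttach
import HarnessLib

/-!
# The SLIDE identity, constructed: three `ofDarts` domains around one attached hexagon («SLIDE-OF-DARTS»)

Topic `Literature/Probability/Percolation`; generic-`k` layer of the marked-loop (Khristoforov–Smirnov) lineage; a rider on `MarkedLoopLawSlide.lean` («LAW-SLIDE»: for a
`SlideData D' D₁ D₂ h r m k₀ i₀` — three `k`-marked domains around one attached hexagon whose corner faces agree except at the slid mark — `lawLP z' = lawLP z₁ + lawLP z₂`) and on
`TriMarkedDomainAttach.lean` («ATTACH-ORDER»: `rebase₀`, `yc_eq_leftFaceDir`, the boundary order under attachment, `ofDarts_markDart_eq_of_orderIso`).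

«LAW-SLIDE» takes the three marked domains as GIVEN. Here they are CONSTRUCTED from coordinate data (`SlideDarts`): two unmarked discrete domains `D₀` on `G` and `D₀'` on
`G' = G ∪ {h}` (`h ∉ G`, outside run of `h` at the ring offsets `k ≤ m` from `r`, contact cells at the offsets `k > m`, `1 ≤ m ≤ 3`, the first contact end `P` a SIMPLE convex
corner of `G`: `h + e_{r+5} + e_r ∈ G`), a boundary dart `bz` of `G` common to both boundaries (the dart of the observed mid-edge `z`; flat, off the marks), and a set `S₀` of
common boundary darts, markable in both and with distinct tails off the two contact cells. The three marked domains are `ofDarts` of the domains REBASED AT `bz`, marked at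
`S₀` plus ONE more dart: `slideQ = (h + e_{r+m+1}, h + e_{r+m})` (the mark at the last contact end `Q`, domain `domQ` on `G`), `slideP = (h + e_{r+5}, h)` (the mark at `P`, domain
`domP` on `G`), `slideA = (h, h + e_{r+1})` (the mark at the first outer-path vertex `a = N_0` of `h`, domain `domA` on `G'`; the only Bollobás–Riordan-markable vertex of the outer
path, a site being marked at its SECOND outside neighbour).

* §1 `slideQ`/`slideP`/`slideA`, `SlideDarts` and its ring facts: `removableAt` (`RemovableAt G' h r (m+1)`), the three darts are markable (`isMarkable_dQ/dP/da`), the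
  marked sets `insert _ S₀` (`card_insert₃`, `markable₃`, `injOn₃`); the marked domains `domQ`, `domP`, `domA : TriMarkedDomain (#S₀ + 1)` (`ofDarts` of the domains rebased
  at `bz`).
* §2 THE MARKS CORRESPOND INDEX BY INDEX: `dpos_lt_dQ_iff_lt_dP` (no mark between `P` and `Q`), ★ `markDart_domP` / ★ `markDart_domA` (the `i`-th mark of `domP` / `domA` is
  that of `domQ` with `slideQ ↦ slideP` / `slideQ ↦ slideA`; «ATTACH-ORDER» §3–§4), `idx` (the index `i₀` of `slideQ`), `markDart_idx`, `markDart_of_ne`.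
* §3 THE CORNER FACES: `predDart_domA_eq` (a common mark has the same predecessor dart in `G'` and in `G`), ★ `yc_of_ne`, ★ `yc_idx` (`N_0` in `domA`, `N_m` in `domQ`, `N_5` in
  `domP`, via `yc_eq_leftFaceDir` and the face identities `leftFaceDir_contactQ`, `leftFaceDir_add_triDir`).
* §4 ★★★ `SlideDarts.slideData : SlideData domA domQ domP h r m 0 idx` — so «LAW-SLIDE» applies: ★★★ `SlideDarts.patternCount_eq_add`; the observed mid-edge: `bz` lies on
  the home stretch of all three (`bz_mem_stretch`), `arcPointQ/P/A = ArcPoint.ofFlatDart`, `arcPoint_v_i`, and ★★★ `SlideDarts.lawLP_eq_add : lawLP arcPointA = lawLP arcPointQ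
  + lawLP arcPointP` — **the SLIDE identity of HOME `FINDING-BSPAN-SLIDE-INDUCTION.md` §2 for constructed domains**, `law(Ω ∪ h; M − q + a) = law(Ω; M) + law(Ω; M − q + p)`, any
  number of marks, any discrete `Ω`, any hexagon attached along a contact arc of 2, 3 or 4 cells.

## References
* M. Khristoforov, S. Smirnov, *Percolation and O(1) loop model*, arXiv:2111.15612 (2021), §1.2 (arXiv v1 p. 2: marked points in cyclic order, the law of the link pattern),
  §2 Definition 3, Remark 6 (pp. 4–5).
* B. Bollobás, O. Riordan, *Percolation*, CUP (2006), Ch. 7 §7.2.2 pp. 168–169 (discrete domains; marked sites at the second outside neighbour; arcs).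
* P. A. Pearce, V. Rittenberg, J. de Gier, B. Nienhuis, *Temperley–Lieb stochastic processes*, J. Phys. A 35 (2002) L661–L668, §2.

## Mathlib / tree
Tree: `MarkedLoopLawSlide` (`SlideData`, `SlideData.patternCount_eq_add`, `SlideData.lawLP_eq_add`), `TriMarkedDomainAttach` (`rebase₀`, `triBdrySucc_injOn`, `predDart_eq_of_succ_eq`,
`yc_eq_leftFaceDir`, `dpos_eq_of_base_eq_iter`, `exists_pos_lt_of_fst_ne`, `iter₁_eq_of_lt`, `card₁_eq`, `dpos_pair_of_lt`, `dpos_lt_dpos_iff_of_common`, `dpos_lt_blk_iff`,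
`dpos_ofDarts_markDart`, `ofDarts_markDart_eq_of_orderIso`), `TriDiscShelling` (`RemovableAt` and its `dPlus`, `blk`, `nw`, `dMinus`, `succ_erase_*`, `iter_erase_eq`, `iter_dMinus`,
`leftFaceDir_add_triDir` in `PolylineTransitFaces`), `TriMarkedRingLocal` (`isMarkable_of_ring`, `add_triDir_add_triDir_add_four`), `TriMarkedDomainOfDarts(Stretch)` (`ofDarts`,
`ofDarts_markDart_mem`, `exists_ofDarts_markDart_eq`, `ofDarts_markDart_injective`, `mem_stretch_ofDarts_last_iff`), `MarkedLoopArcPointOfDart` (`ArcPoint.ofFlatDart`,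
`ofFlatDart_v`, `side_ofFlatDart`), `MarkedLoopSpace` (`yc`, `eq_yc`, `hBonds`, `mem_hBonds`), `TriChordSides` (`hexFaceVertices_injective`).
-/

noncomputable section

open Finset

namespace Literature.Probability.Percolation.MarkedLoops

open Literature.Probability.Percolation Literature.Probability.LatticeModels
open Literature.Probability.Percolation.FivePoint (side side_injective)
open TriMarkedDomain

/-! ## §1 The datum, the three darts, the three domains -/

/-- **the mark at the last contact end `Q`** (site `h + e_{r+m+1}`, pointing to `h + e_{r+m}`). [cite: BollobasRiordan2006, Ch. 7 §7.2.2 p. 169; lane tool notion] -/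
def slideQ (h : Site 2) (r m : Fin 6) : Site 2 × Site 2 := (h + triDir (r + (m + 1)), h + triDir (r + m))

/-- **the mark at the first contact end `P`** (site `h + e_{r+5}`, pointing to `h`). [cite: BollobasRiordan2006, Ch. 7 §7.2.2 p. 169; lane tool notion] -/
def slideP (h : Site 2) (r : Fin 6) : Site 2 × Site 2 := (h + triDir (r + 5), h)

/-- **the slid mark at `a = N_0`** (site `h`, pointing to `h + e_{r+1}`). [cite: BollobasRiordan2006, Ch. 7 §7.2.2 p. 169; lane tool notion] -/
def slideA (h : Site 2) (r : Fin 6) : Site 2 × Site 2 := (h, h + triDir (r + 1))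

/-- **SLIDE DATA IN COORDINATES.** Two unmarked discrete domains `D₀` on `G` and `D₀'` on `G ∪ {h}` (`h ∉ G`; the neighbours of `h` at ring offsets `k ≤ m` from `r` outside `G`,
those at offsets `k > m` inside; `1 ≤ m ≤ 3`; the first contact end a simple corner: `h + e_{r+5} + e_r ∈ G`), a common boundary dart `bz` (flat: both apices in `G`; not the dart
of the last contact end), and a set `S₀` of common boundary darts, markable in both, tails pairwise distinct and off the two contact cells carrying the ends `P`, `Q`, not
containing `bz` or the `Q`-dart. [cite: BollobasRiordan2006, Ch. 7 §7.2.2 pp. 168–169; KhristoforovSmirnov2021, §1.2 (arXiv v1 p. 2)] -/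
structure SlideDarts (D₀ D₀' : TriMarkedDomain 0) (h : Site 2) (r m : Fin 6) (bz : Site 2 × Site 2) (S₀ : Finset (Site 2 × Site 2)) : Prop where
  /-- the big domain is the small one plus `h` -/
  verts' : D₀'.verts = insert h D₀.verts
  /-- `h` is new -/
  not_mem : h ∉ D₀.verts
  /-- the outer run of `h` -/
  out : ∀ k : Fin 6, k ≤ m → h + triDir (r + k) ∉ D₀.verts
  /-- the contact arc of `h` -/
  inside : ∀ k : Fin 6, m < k → h + triDir (r + k) ∈ D₀.verts
  /-- at least two outer-path bonds -/
  one_le : 1 ≤ m.val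
  /-- at least two contact cells -/
  m_le : m.val ≤ 3
  /-- the first contact end `P` is a simple convex corner of `G` -/
  simpleP : h + triDir (r + 5) + triDir r ∈ D₀.verts
  /-- the observed dart is a boundary dart of `G` … -/
  bz_mem : bz ∈ triBdryDarts D₀.verts
  /-- … common to `G'` … -/
  bz_snd : bz.2 ≠ h
  /-- … other than the `Q`-dart … -/
  bz_ne : bz ≠ slideQ h r m
  /-- … not a mark … -/
  bz_not_mem : bz ∉ S₀
  /-- … and flat: both apices of its bond are cells of `G` -/
  flat : triLeftApex bz.1 bz.2 ∈ D₀.verts ∧ triLeftApex bz.2 bz.1 ∈ D₀.verts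
  /-- the common marks are boundary darts of `G` common to `G'` -/
  sub : ∀ d ∈ S₀, d ∈ triBdryDarts D₀.verts ∧ d.2 ≠ h
  /-- markable in `G` -/
  mark : ∀ d ∈ S₀, IsMarkable D₀.verts d
  /-- markable in `G'` -/
  mark' : ∀ d ∈ S₀, IsMarkable D₀'.verts d
  /-- with pairwise distinct tails … -/
  inj : Set.InjOn Prod.fst (S₀ : Set (Site 2 × Site 2))
  /-- … off the two contact cells carrying the ends -/
  fst_ne : ∀ d ∈ S₀, d.1 ≠ (slideQ h r m).1 ∧ d.1 ≠ (slideP h r).1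
  /-- the `Q`-dart is not a common mark -/
  dQ_not_mem : slideQ h r m ∉ S₀

namespace SlideDarts

variable {D₀ D₀' : TriMarkedDomain 0} {h : Site 2} {r m : Fin 6} {bz : Site 2 × Site 2} {S₀ : Finset (Site 2 × Site 2)} (T : SlideDarts D₀ D₀' h r m bz S₀)
include T

/-! ### `Fin 6` constants -/

omit T in
/-- `Fin 6` facts for `m ≤ 3`. [cite: BollobasRiordan2006, Ch. 7 §7.2.2 p. 168; lane plumbing] -/
private theorem finm (m : Fin 6) (hm : m.val ≤ 3) :
    (m + 1).val = m.val + 1 ∧ m < m + 1 ∧ m < m + 2 ∧ m + 1 - 1 = m ∧ m + 1 + 1 = m + 2 ∧ m + 1 + 5 = m ∧ m < 5 ∧ (5 : Fin 6) ≠ m + 1 := by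
  revert hm; revert m; decide

omit T in
/-- `Fin 6` constants around the contact cell of `Q`. [cite: BollobasRiordan2006, Ch. 7 §7.2.2 p. 168; lane plumbing] -/
private theorem fin3 (x : Fin 6) : x + 3 + 5 = x + 2 ∧ x + 3 + 1 = x + 4 := by
  revert x; decide

omit T in
/-- `Fin 6` constants. [cite: BollobasRiordan2006, Ch. 7 §7.2.2 p. 168; lane plumbing] -/
private theorem fin5 (r : Fin 6) : r + 5 + 1 = r ∧ r + 5 + 2 = r + 1 ∧ r + 5 + 3 = r + 2 ∧ r + 1 + 5 = r ∧ r + 1 + 1 = r + 2 ∧ r + 0 = r := by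
  revert r; decide

/-! ### Sites and the removable hexagon -/

/-- `G = G' ∖ {h}`. [cite: BollobasRiordan2006, Ch. 7 §7.2.2 p. 168] -/
theorem verts_eq_erase : D₀.verts = D₀'.verts.erase h := by rw [T.verts', Finset.erase_insert T.not_mem]

/-- `h ∈ G'`. [cite: BollobasRiordan2006, Ch. 7 §7.2.2 p. 168] -/
theorem h_mem' : h ∈ D₀'.verts := by rw [T.verts']; exact Finset.mem_insert_self _ _

/-- ★ **`h` is a removable hexagon of `G'`** with the block of `m + 1` outside neighbours from offset `r`. [cite: BollobasRiordan2006, Ch. 7 §7.2.2 p. 168] -/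
theorem removableAt : RemovableAt D₀'.verts h r (m + 1) where
  mem := T.h_mem'
  one_le := by rw [(finm m T.m_le).1]; omega
  out_iff := by
    intro t
    rw [T.verts', Finset.mem_insert, not_or, (finm m T.m_le).1]
    constructor
    · rintro ⟨-, ht⟩
      by_contra hlt
      exact ht (T.inside t (by rw [Fin.lt_def]; omega))
    · intro ht
      exact ⟨fun e => add_triDir_ne h _ e, T.out t (by rw [Fin.le_def]; omega)⟩

/-- `dQ` is `dPlus` of the removable hexagon. [cite: BollobasRiordan2006, Ch. 7 §7.2.2 p. 168; lane plumbing] -/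
theorem dQ_eq_dPlus : slideQ h r m = RemovableAt.dPlus h r (m + 1) := by
  unfold slideQ RemovableAt.dPlus
  rw [(finm m T.m_le).2.2.2.1]

omit T in
/-- `da` is the block dart of offset `1`. [cite: BollobasRiordan2006, Ch. 7 §7.2.2 p. 168; lane plumbing] -/
theorem da_eq_blk : slideA h r = RemovableAt.blk h r 1 := rfl

omit T in
/-- `dP` is the new dart of offset `5`. [cite: BollobasRiordan2006, Ch. 7 §7.2.2 p. 168; lane plumbing] -/
theorem dP_eq_nw : slideP h r = RemovableAt.nw h r 5 := rfl

/-- the observed dart is a dart of `∂G'`, with tail off `h`. [cite: BollobasRiordan2006, Ch. 7 §7.2.2 p. 168] -/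
theorem bz_mem' : bz ∈ triBdryDarts D₀'.verts ∧ bz.1 ≠ h := by
  obtain ⟨h1, h2, h3⟩ := mem_triBdryDarts.1 T.bz_mem
  refine ⟨mem_triBdryDarts.2 ⟨?_, ?_, h3⟩, fun e => T.not_mem (e ▸ h1)⟩
  · rw [T.verts']; exact Finset.mem_insert_of_mem h1
  · rw [T.verts', Finset.mem_insert, not_or]; exact ⟨T.bz_snd, h2⟩

/-- a common mark is a dart of `∂G'` with tail off `h`. [cite: BollobasRiordan2006, Ch. 7 §7.2.2 p. 168] -/
theorem mem'_of_mem {d : Site 2 × Site 2} (hd : d ∈ S₀) : d ∈ triBdryDarts D₀'.verts ∧ d.1 ≠ h :=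
  ⟨(T.mark' d hd).mem, fun e => T.not_mem (e ▸ (mem_triBdryDarts.1 (T.sub d hd).1).1)⟩

/-! ### The three darts are markable -/

/-- ★ **`dQ` is markable in `G`** (the walk enters `h + e_{r+m+1}` from `h + e_{r+m+2}`, turns at `h`, then at `h + e_{r+m}`). [cite: BollobasRiordan2006, Ch. 7 §7.2.2 p. 169] -/
theorem isMarkable_dQ : IsMarkable D₀.verts (slideQ h r m) := by
  have F := finm m T.m_le
  set J₀ := r + (m + 1) with hJ₀
  set g := h + triDir J₀ with hg
  have hgm : g ∈ D₀.verts := T.inside (m + 1) F.2.1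
  -- the neighbours of `g` at directions `J₀ + 2`, `J₀ + 3`, `J₀ + 4`
  have e2 : g + triDir (J₀ + 3 + 5) = h + triDir (r + (m + 2)) := by
    rw [(fin3 J₀).1, hg, add_assoc h, triDir_add_triDir_add_two, hJ₀, add_assoc r, F.2.2.2.2.1]
  have e3 : g + triDir (J₀ + 3) = h := by
    rw [hg, add_assoc h, triDir_add_three, add_neg_cancel, add_zero]
  have e4 : g + triDir (J₀ + 3 + 1) = h + triDir (r + m) := by
    rw [(fin3 J₀).2, hg, add_triDir_add_triDir_add_four, hJ₀, add_assoc r, F.2.2.2.2.2.1]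
  have hmk := isMarkable_of_ring (G := D₀.verts) (g := g) (J₀ + 3) hgm (by rw [e2]; exact T.inside (m + 2) F.2.2.1) (by rw [e3]; exact T.not_mem)
    (by rw [e4]; exact T.out m le_rfl)
  rwa [e4] at hmk

/-- ★ **`dP` is markable in `G`** (the walk enters `h + e_{r+5}` from `h + e_{r+5} + e_r`, turns at `h + e_r`, then at `h`). [cite: BollobasRiordan2006, Ch. 7 §7.2.2 p. 169] -/
theorem isMarkable_dP : IsMarkable D₀.verts (slideP h r) := by
  have F := fin5 r
  set g := h + triDir (r + 5) with hg
  have hgm : g ∈ D₀.verts := T.inside 5 (finm m T.m_le).2.2.2.2.2.2.1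
  have e1 : g + triDir (r + 1) = h + triDir r := by
    rw [hg, add_assoc h, ← F.2.1, triDir_add_triDir_add_two, F.1]
  have e2 : g + triDir (r + 1 + 1) = h := by
    rw [hg, F.2.2.2.2.1, add_assoc h, ← F.2.2.1, triDir_add_three, add_neg_cancel, add_zero]
  have h0 : h + triDir r ∉ D₀.verts := by have := T.out 0 (Fin.zero_le _); rwa [add_zero] at this
  have hmk := isMarkable_of_ring (G := D₀.verts) (g := g) (r + 1) hgm (by rw [F.2.2.2.1]; exact T.simpleP) (by rw [e1]; exact h0)
    (by rw [e2]; exact T.not_mem)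
  rwa [e2] at hmk

/-- ★ **`da` is markable in `G'`** (the walk enters `h` from `h + e_{r+5}`, turns at `h + e_r`, then at `h + e_{r+1}`). [cite: BollobasRiordan2006, Ch. 7 §7.2.2 p. 169] -/
theorem isMarkable_da : IsMarkable D₀'.verts (slideA h r) := by
  have R := T.removableAt
  have F := finm m T.m_le
  have h0 := R.out (t := 0) (by rw [F.1]; simp)
  rw [add_zero] at h0
  exact isMarkable_of_ring (G := D₀'.verts) (g := h) r T.h_mem' (R.inside (t := 5) (by rw [F.1]; simp; omega)) h0
    (R.out (t := 1) (by rw [F.1]; have := T.one_le; simp; omega))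

/-! ### The marked sets -/

/-- `dP ∉ S₀` (its head is `h`) and `da ∉ S₀` (its tail is `h`). [cite: BollobasRiordan2006, Ch. 7 §7.2.2 p. 169; lane plumbing] -/
theorem dP_da_not_mem : slideP h r ∉ S₀ ∧ slideA h r ∉ S₀ :=
  ⟨fun hd => (T.sub _ hd).2 rfl, fun hd => (T.mem'_of_mem hd).2 rfl⟩

/-- cards of the marked sets. [cite: BollobasRiordan2006, Ch. 7 §7.2.2 p. 169; lane plumbing] -/
theorem card_insert₃ : #(insert (slideQ h r m) S₀) = #S₀ + 1 ∧ #(insert (slideP h r) S₀) = #S₀ + 1 ∧ #(insert (slideA h r) S₀) = #S₀ + 1 :=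
  ⟨Finset.card_insert_of_notMem T.dQ_not_mem, Finset.card_insert_of_notMem T.dP_da_not_mem.1, Finset.card_insert_of_notMem T.dP_da_not_mem.2⟩

/-- markability of the marked sets (rebasing does not change the sites). [cite: BollobasRiordan2006, Ch. 7 §7.2.2 p. 169] -/
theorem markable₃ : (∀ d ∈ insert (slideQ h r m) S₀, IsMarkable (D₀.rebase₀ T.bz_mem).verts d) ∧ (∀ d ∈ insert (slideP h r) S₀, IsMarkable (D₀.rebase₀ T.bz_mem).verts d) ∧
    (∀ d ∈ insert (slideA h r) S₀, IsMarkable (D₀'.rebase₀ T.bz_mem'.1).verts d) := by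
  refine ⟨fun d hd => ?_, fun d hd => ?_, fun d hd => ?_⟩
  · rcases Finset.mem_insert.1 hd with rfl | hd
    · exact T.isMarkable_dQ
    · exact T.mark d hd
  · rcases Finset.mem_insert.1 hd with rfl | hd
    · exact T.isMarkable_dP
    · exact T.mark d hd
  · rcases Finset.mem_insert.1 hd with rfl | hd
    · exact T.isMarkable_da
    · exact T.mark' d hd

/-- tails are pairwise distinct in each marked set. [cite: BollobasRiordan2006, Ch. 7 §7.2.2 p. 169 (distinct marked sites)] -/
theorem injOn₃ : Set.InjOn Prod.fst ((insert (slideQ h r m) S₀ : Finset (Site 2 × Site 2)) : Set (Site 2 × Site 2)) ∧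
    Set.InjOn Prod.fst ((insert (slideP h r) S₀ : Finset (Site 2 × Site 2)) : Set (Site 2 × Site 2)) ∧
    Set.InjOn Prod.fst ((insert (slideA h r) S₀ : Finset (Site 2 × Site 2)) : Set (Site 2 × Site 2)) := by
  have key : ∀ x : Site 2 × Site 2, (∀ d ∈ S₀, d.1 ≠ x.1) → Set.InjOn Prod.fst ((insert x S₀ : Finset (Site 2 × Site 2)) : Set (Site 2 × Site 2)) := by
    intro x hx d hd d' hd' e
    rw [Finset.coe_insert, Set.mem_insert_iff] at hd hd'
    rcases hd with rfl | hd <;> rcases hd' with rfl | hd'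
    · rfl
    · exact absurd e.symm (hx d' hd')
    · exact absurd e (hx d hd)
    · exact T.inj hd hd' e
  exact ⟨key _ fun d hd => (T.fst_ne d hd).1, key _ fun d hd => (T.fst_ne d hd).2, key _ fun d hd => (T.mem'_of_mem hd).2⟩

/-- **the domain `D₁ = (Ω; M)` with the mark at `Q`**: `G` rebased at `bz`, marked at `S₀ ∪ {dQ}`. [cite: BollobasRiordan2006, Ch. 7 §7.2.2 pp. 168–169; KhristoforovSmirnov2021, §1.2 (arXiv v1 p. 2)] -/
def domQ : TriMarkedDomain (#S₀ + 1) :=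
  (D₀.rebase₀ T.bz_mem).ofDarts (Nat.succ_pos _) (insert (slideQ h r m) S₀) T.card_insert₃.1 T.markable₃.1 T.injOn₃.1

/-- **the domain `D₂ = (Ω; M − q + p)` with the mark at `P`.** [cite: BollobasRiordan2006, Ch. 7 §7.2.2 pp. 168–169; KhristoforovSmirnov2021, §1.2 (arXiv v1 p. 2)] -/
def domP : TriMarkedDomain (#S₀ + 1) :=
  (D₀.rebase₀ T.bz_mem).ofDarts (Nat.succ_pos _) (insert (slideP h r) S₀) T.card_insert₃.2.1 T.markable₃.2.1 T.injOn₃.2.1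

/-- **the domain `D' = (Ω ∪ h; M − q + a)` with the slid mark at `a = N_0`.** [cite: BollobasRiordan2006, Ch. 7 §7.2.2 pp. 168–169; KhristoforovSmirnov2021, §1.2 (arXiv v1 p. 2)] -/
def domA : TriMarkedDomain (#S₀ + 1) :=
  (D₀'.rebase₀ T.bz_mem'.1).ofDarts (Nat.succ_pos _) (insert (slideA h r) S₀) T.card_insert₃.2.2 T.markable₃.2.2 T.injOn₃.2.2

/-- their sites. [cite: BollobasRiordan2006, Ch. 7 §7.2.2 p. 168; lane plumbing] -/
theorem verts₃ : T.domQ.verts = D₀.verts ∧ T.domP.verts = D₀.verts ∧ T.domA.verts = D₀'.verts := ⟨rfl, rfl, rfl⟩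

/-! ## §2 The marks correspond index by index -/

/-- positions of the new darts and of `dQ` in the rebased `G`: `dP = nw 5` sits right after the common stretch, `dQ = dPlus` at its very end, and every common dart is either
before both or after both. [cite: BollobasRiordan2006, Ch. 7 §7.2.2 p. 168 (the boundary cycle)] -/
theorem dpos_lt_dQ_iff_lt_dP {d : Site 2 × Site 2} (hd : d ∈ triBdryDarts D₀'.verts) (hdh : d.1 ≠ h) :
    ((D₀.rebase₀ T.bz_mem).dpos d < (D₀.rebase₀ T.bz_mem).dpos (slideQ h r m) ↔ (D₀.rebase₀ T.bz_mem).dpos d < (D₀.rebase₀ T.bz_mem).dpos (slideP h r)) ∧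
      (D₀.rebase₀ T.bz_mem).dpos (slideP h r) ≤ (D₀.rebase₀ T.bz_mem).dpos (slideQ h r m) := by
  have R := T.removableAt
  have F := finm m T.m_le
  set E' := D₀'.rebase₀ T.bz_mem'.1 with hE'
  set E := D₀.rebase₀ T.bz_mem with hE
  have R' : RemovableAt E'.verts h r (m + 1) := R
  have hV : E.verts = E'.verts.erase h := T.verts_eq_erase
  have hB : E.base = E'.base := rfl
  have hbP : E'.base ≠ RemovableAt.dPlus h r (m + 1) := by rw [← T.dQ_eq_dPlus]; exact T.bz_ne
  have hL₁ := card₁_eq R' hV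
  have h5 : (m + 1).val ≤ 5 := R'.le_five
  obtain ⟨hL2, -⟩ := R'.iter_dMinus E'.isTriDisc
  obtain ⟨β, h1β, hβ, hb⟩ := exists_base_pos R' T.bz_mem'.2 hbP
  obtain ⟨n, hn, rfl⟩ := exists_pos_lt_of_fst_ne R' hd hdh
  obtain ⟨-, e2⟩ := dpos_pair_of_lt R' hV hB hβ hb hn
  -- `dQ = dPlus`: position `0` from `dPlus`
  have eQ : E.dpos (slideQ h r m) = #(triBdryDarts E.verts) - β := by
    have := (dpos_pair_of_lt R' hV hB hβ hb (n := 0) (by omega)).2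
    rw [triBdryIter_zero, if_neg (by omega)] at this
    rw [T.dQ_eq_dPlus, this]; omega
  -- `dP = nw 5`: position `#∂G' − (m+1)` from `dPlus` in `G`
  have eP : E.dpos (slideP h r) = #(triBdryDarts E'.verts) - (m + 1).val - β := by
    have hP1 : RemovableAt.dPlus h r (m + 1) ∈ triBdryDarts E.verts := by rw [hV]; exact R'.dPlus_mem_erase
    have hit : triBdryIter E.verts (RemovableAt.dPlus h r (m + 1)) (#(triBdryDarts E'.verts) - (m + 1).val) = slideP h r := by
      rw [hV, (R'.iter_erase_eq E'.isTriDisc).1 _ (by omega), RemovableAt.newIter, if_neg (by omega), dP_eq_nw]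
      congr 1
      apply Fin.ext
      rw [RemovableAt.val_ofNat_of_le (by omega), show ((5 : Fin 6) : ℕ) = 5 from rfl]; omega
    have key := E.dpos_eq_of_base_eq_iter hP1 (β := β) (n := #(triBdryDarts E'.verts) - (m + 1).val) (by omega) (by rw [hB, iter₁_eq_of_lt R' hV hβ, hb])
      (by omega)
    rw [hit, if_pos (by omega)] at key
    exact key
  rw [e2, eQ, eP]
  constructor
  · split_ifs <;> omega
  · omega

/-- ★ **THE MARKS OF `domP` ARE THOSE OF `domQ` WITH `dQ ↦ dP`.** [cite: BollobasRiordan2006, Ch. 7 §7.2.2 p. 169 (marked sites in anticlockwise order); KhristoforovSmirnov2021, §1.2 (arXiv v1 p. 2)] -/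
theorem markDart_domP (i : Fin (#S₀ + 1)) : T.domP.markDart i = (fun d => if d = slideQ h r m then slideP h r else d) (T.domQ.markDart i) := by
  classical
  set E := D₀.rebase₀ T.bz_mem with hE
  have hcom : ∀ d ∈ S₀, d ∈ triBdryDarts D₀'.verts ∧ d.1 ≠ h := fun d hd => T.mem'_of_mem hd
  refine ofDarts_markDart_eq_of_orderIso (D := E) (D' := E) (Nat.succ_pos _) T.card_insert₃.1 T.markable₃.1 T.injOn₃.1 T.card_insert₃.2.1 T.markable₃.2.1 T.injOn₃.2.1
    (fun d => if d = slideQ h r m then slideP h r else d) (fun d hd => ?_) (fun d hd d' hd' hlt => ?_) i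
  · rcases Finset.mem_insert.1 hd with rfl | hd
    · rw [if_pos rfl]; exact Finset.mem_insert_self _ _
    · rw [if_neg (fun e : d = slideQ h r m => T.dQ_not_mem (e ▸ hd))]; exact Finset.mem_insert_of_mem hd
  · rcases Finset.mem_insert.1 hd with rfl | hd <;> rcases Finset.mem_insert.1 hd' with rfl | hd'
    · exact absurd hlt (lt_irrefl _)
    · -- `dQ < d'` ⇒ `dP < d'`
      rw [if_pos rfl, if_neg (fun e : d' = slideQ h r m => T.dQ_not_mem (e ▸ hd'))]
      have h1 := T.dpos_lt_dQ_iff_lt_dP (hcom d' hd').1 (hcom d' hd').2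
      exact lt_of_le_of_lt h1.2 hlt
    · -- `d < dQ` ⇒ `d < dP`
      rw [if_pos rfl, if_neg (fun e : d = slideQ h r m => T.dQ_not_mem (e ▸ hd))]
      exact (T.dpos_lt_dQ_iff_lt_dP (hcom d hd).1 (hcom d hd).2).1.1 hlt
    · rw [if_neg (fun e : d = slideQ h r m => T.dQ_not_mem (e ▸ hd)), if_neg (fun e : d' = slideQ h r m => T.dQ_not_mem (e ▸ hd'))]; exact hlt

/-- ★ **THE MARKS OF `domA` ARE THOSE OF `domQ` WITH `dQ ↦ da`** («ATTACH-ORDER»: common darts compare identically in `G` and `G'`, and the block dart `da` of `G'` sits in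
the slot of `dPlus = dQ` of `G`). [cite: BollobasRiordan2006, Ch. 7 §7.2.2 p. 169 (marked sites in anticlockwise order); KhristoforovSmirnov2021, §1.2 (arXiv v1 p. 2)] -/
theorem markDart_domA (i : Fin (#S₀ + 1)) : T.domA.markDart i = (fun d => if d = slideQ h r m then slideA h r else d) (T.domQ.markDart i) := by
  classical
  have R := T.removableAt
  have F := finm m T.m_le
  set E' := D₀'.rebase₀ T.bz_mem'.1 with hE'
  set E := D₀.rebase₀ T.bz_mem with hE
  have R' : RemovableAt E'.verts h r (m + 1) := R
  have hV : E.verts = E'.verts.erase h := T.verts_eq_erase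
  have hB : E.base = E'.base := rfl
  have hbP : E'.base ≠ RemovableAt.dPlus h r (m + 1) := by rw [← T.dQ_eq_dPlus]; exact T.bz_ne
  have hcom : ∀ d ∈ S₀, d ∈ triBdryDarts D₀'.verts ∧ d.1 ≠ h := fun d hd => T.mem'_of_mem hd
  have hda : ∀ d ∈ S₀, d ≠ slideA h r := fun d hd e => T.dP_da_not_mem.2 (e ▸ hd)
  -- the order facts
  have blkQ : ∀ d ∈ S₀, E'.dpos d < E'.dpos (slideA h r) ↔ E.dpos d < E.dpos (slideQ h r m) := by
    intro d hd
    rw [T.dQ_eq_dPlus, da_eq_blk]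
    exact dpos_lt_blk_iff R' hV hB T.bz_mem'.2 hbP (hcom d hd).1 (hcom d hd).2 1 (by rw [F.1]; have := T.one_le; simp; omega)
  have hinjE' : ∀ d d' : Site 2 × Site 2, d ∈ triBdryDarts E'.verts → d' ∈ triBdryDarts E'.verts → E'.dpos d = E'.dpos d' → d = d' := by
    intro d d' h1 h2 e; rw [← E'.iter_dpos h1, ← E'.iter_dpos h2, e]
  refine ofDarts_markDart_eq_of_orderIso (D := E) (D' := E') (Nat.succ_pos _) T.card_insert₃.1 T.markable₃.1 T.injOn₃.1 T.card_insert₃.2.2 T.markable₃.2.2 T.injOn₃.2.2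
    (fun d => if d = slideQ h r m then slideA h r else d) (fun d hd => ?_) (fun d hd d' hd' hlt => ?_) i
  · rcases Finset.mem_insert.1 hd with rfl | hd
    · rw [if_pos rfl]; exact Finset.mem_insert_self _ _
    · rw [if_neg (fun e : d = slideQ h r m => T.dQ_not_mem (e ▸ hd))]; exact Finset.mem_insert_of_mem hd
  · rcases Finset.mem_insert.1 hd with rfl | hd <;> rcases Finset.mem_insert.1 hd' with rfl | hd'
    · exact absurd hlt (lt_irrefl _)
    · -- `dQ < d'` in `G` ⇒ `da < d'` in `G'`
      rw [if_pos rfl, if_neg (fun e : d' = slideQ h r m => T.dQ_not_mem (e ▸ hd'))]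
      have h1 : ¬ E'.dpos d' < E'.dpos (slideA h r) := fun h' => lt_asymm hlt ((blkQ d' hd').1 h')
      have h2 : E'.dpos d' ≠ E'.dpos (slideA h r) := fun e => hda d' hd' (hinjE' _ _ (hcom d' hd').1 T.isMarkable_da.mem e)
      omega
    · rw [if_pos rfl, if_neg (fun e : d = slideQ h r m => T.dQ_not_mem (e ▸ hd))]
      exact (blkQ d hd).2 hlt
    · rw [if_neg (fun e : d = slideQ h r m => T.dQ_not_mem (e ▸ hd)), if_neg (fun e : d' = slideQ h r m => T.dQ_not_mem (e ▸ hd'))]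
      exact (dpos_lt_dpos_iff_of_common R' hV hB T.bz_mem'.2 hbP (hcom d hd).1 (hcom d hd).2 (hcom d' hd').1 (hcom d' hd').2).2 hlt

/-- **the index `i₀` of the moved mark** (the index of `dQ` among the marks of `domQ`). [cite: KhristoforovSmirnov2021, §1.2 (arXiv v1 p. 2); lane tool notion] -/
def idx : Fin (#S₀ + 1) := (exists_ofDarts_markDart_eq (D₀.rebase₀ T.bz_mem) (Nat.succ_pos _) (insert (slideQ h r m) S₀) T.card_insert₃.1 T.markable₃.1 T.injOn₃.1
  (Finset.mem_insert_self _ _)).choose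

/-- the `i₀`-th marks: `dQ`, `dP`, `da`. [cite: KhristoforovSmirnov2021, §1.2 (arXiv v1 p. 2)] -/
theorem markDart_idx : T.domQ.markDart T.idx = slideQ h r m ∧ T.domP.markDart T.idx = slideP h r ∧ T.domA.markDart T.idx = slideA h r := by
  have hQ : T.domQ.markDart T.idx = slideQ h r m := (exists_ofDarts_markDart_eq (D₀.rebase₀ T.bz_mem) (Nat.succ_pos _) (insert (slideQ h r m) S₀) T.card_insert₃.1
    T.markable₃.1 T.injOn₃.1 (Finset.mem_insert_self _ _)).choose_spec
  refine ⟨hQ, ?_, ?_⟩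
  · rw [T.markDart_domP, hQ]; exact if_pos rfl
  · rw [T.markDart_domA, hQ]; exact if_pos rfl

/-- the other marks are common marks, the same in all three domains. [cite: KhristoforovSmirnov2021, §1.2 (arXiv v1 p. 2)] -/
theorem markDart_of_ne {i : Fin (#S₀ + 1)} (hi : i ≠ T.idx) :
    T.domQ.markDart i ∈ S₀ ∧ T.domP.markDart i = T.domQ.markDart i ∧ T.domA.markDart i = T.domQ.markDart i := by
  have hne : T.domQ.markDart i ≠ slideQ h r m := by
    rw [← T.markDart_idx.1]
    exact fun e => hi (ofDarts_markDart_injective _ _ _ _ _ _ e)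
  have hmem := ofDarts_markDart_mem (D₀.rebase₀ T.bz_mem) (Nat.succ_pos _) (insert (slideQ h r m) S₀) T.card_insert₃.1 T.markable₃.1 T.injOn₃.1 i
  refine ⟨(Finset.mem_insert.1 hmem).resolve_left hne, ?_, ?_⟩
  · rw [T.markDart_domP]; exact if_neg hne
  · rw [T.markDart_domA]; exact if_neg hne

/-! ## §3 The corner faces -/

/-- **a common mark has the same predecessor dart in `G'` and in `G`** (its `G`-predecessor is an old dart other than `dMinus`, where the two successors agree).
[cite: BollobasRiordan2006, Ch. 7 §7.2.2 p. 169 (marked at the second outside neighbour)] -/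
theorem predDart_domA_eq {i : Fin (#S₀ + 1)} (hi : i ≠ T.idx) : predDart T.domA i = predDart T.domQ i := by
  have R := T.removableAt
  have F := finm m T.m_le
  obtain ⟨hS, -, hA⟩ := T.markDart_of_ne hi
  set d := T.domQ.markDart i with hd
  set d₁ := predDart T.domQ i with hd₁
  have hd₁m : d₁ ∈ triBdryDarts D₀.verts := predDart_mem T.domQ i
  have hsucc : triBdrySucc D₀.verts d₁ = d := succ_predDart T.domQ i
  obtain ⟨hx, hy, hadj⟩ := mem_triBdryDarts.1 hd₁m
  have hd2 : d.2 ≠ h := (T.sub d hS).2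
  -- the head of `d₁` is not `h`: otherwise `d₁ = nw t` and its successor has head `h` or is `dQ`
  have hd₁2 : d₁.2 ≠ h := by
    intro e
    obtain ⟨j, hj⟩ := (triGraph_adj_iff_triDir d₁.2 d₁.1).1 hadj.symm
    rw [e] at hj
    obtain ⟨t, rfl⟩ : ∃ t : Fin 6, j = r + t := ⟨j - r, by rw [add_sub_cancel]⟩
    have hd₁eq : d₁ = RemovableAt.nw h r t := Prod.ext hj e
    have ht : (m + 1).val ≤ t.val := by
      by_contra hlt
      exact (R.out (t := t) (by omega)) (by rw [T.verts']; exact Finset.mem_insert_of_mem (hj ▸ hx))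
    rw [hd₁eq, T.verts_eq_erase] at hsucc
    rcases (Nat.lt_or_eq_of_le ht) with hlt | heq
    · rw [R.succ_erase_nw hlt] at hsucc
      exact hd2 (by rw [← hsucc]; rfl)
    · have htm : t = m + 1 := (Fin.ext heq).symm
      rw [htm, R.succ_erase_nw_last, ← T.dQ_eq_dPlus] at hsucc
      have hQS : slideQ h r m ∈ S₀ := hsucc ▸ hS
      exact T.dQ_not_mem hQS
  have hd₁' : d₁ ∈ triBdryDarts D₀'.verts := by
    refine mem_triBdryDarts.2 ⟨by rw [T.verts']; exact Finset.mem_insert_of_mem hx, ?_, hadj⟩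
    rw [T.verts', Finset.mem_insert, not_or]; exact ⟨hd₁2, hy⟩
  -- `d₁ ≠ dMinus` (whose `G`-successor is `dP`, head `h`)
  have hdm : d₁ ≠ RemovableAt.dMinus h r := by
    intro e
    rw [e, T.verts_eq_erase, RemovableAt.succ_erase_dMinus] at hsucc
    exact hd2 (by rw [← hsucc]; rfl)
  have hsucc' : triBdrySucc D₀'.verts d₁ = T.domA.markDart i := by
    rw [hA, ← hsucc, T.verts_eq_erase]
    exact (R.succ_erase_eq hd₁' hdm).symm
  exact T.domA.predDart_eq_of_succ_eq i hd₁' hsucc'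

/-- ★ **the corner faces of the common marks agree** (`D'` vs `D₁`, and `D₂` vs `D₁`). [cite: KhristoforovSmirnov2021, §1.2 (arXiv v1 p. 2: the corner disorders); BollobasRiordan2006, Ch. 7 §7.2.2 p. 169] -/
theorem yc_of_ne {i : Fin (#S₀ + 1)} (hi : i ≠ T.idx) : yc T.domA i = yc T.domQ i ∧ yc T.domP i = yc T.domQ i := by
  obtain ⟨-, hP, hA⟩ := T.markDart_of_ne hi
  have hpredP : predDart T.domP i = predDart T.domQ i :=
    T.domP.predDart_eq_of_succ_eq i (predDart_mem T.domQ i) (by rw [hP]; exact succ_predDart T.domQ i)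
  constructor
  · apply eq_yc
    unfold IsCornerFace
    rw [yc_spec T.domA i, TriMarkedDomain.markSite, TriMarkedDomain.markSite, hA, T.predDart_domA_eq hi]
  · apply eq_yc
    unfold IsCornerFace
    rw [yc_spec T.domP i, TriMarkedDomain.markSite, TriMarkedDomain.markSite, hP, hpredP]

omit T in
/-- **the face at the last contact end, seen from the contact cell**: `leftFaceDir (h + e_{j+1}) (j + 4) = leftFaceDir h j` (both have the vertices `h`, `h + e_j`, `h + e_{j+1}`).
[cite: BollobasRiordan2006, Ch. 7 §7.2.2 p. 168; lane plumbing] -/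
theorem leftFaceDir_contactQ (h : Site 2) (j : Fin 6) : leftFaceDir (h + triDir (j + 1)) (j + 4) = leftFaceDir h j := by
  apply hexFaceVertices_injective
  have e4 : h + triDir (j + 1) + triDir (j + 4) = h := by
    rw [add_assoc, show j + 4 = j + 1 + 3 by rw [add_assoc]; rfl, triDir_add_three, add_neg_cancel, add_zero]
  have e5 : h + triDir (j + 1) + triDir (j + 4 + 1) = h + triDir j := by
    rw [show j + 4 + 1 = j + 1 + 4 by abel, add_triDir_add_triDir_add_four, show j + 1 + 5 = j by rw [add_assoc]; exact add_eq_left.2 (by decide)]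
  rw [RemovableAt.hexFaceVertices_leftFaceDir, RemovableAt.hexFaceVertices_leftFaceDir, e4, e5]
  ext x
  simp only [Finset.mem_insert, Finset.mem_singleton]
  tauto

/-- ★ **the three `i₀`-th corner faces: `a = N_0` in `D'`, `Q = N_m` in `D₁`, `P = N_5` in `D₂`.** [cite: KhristoforovSmirnov2021, §1.2 (arXiv v1 p. 2: the corner disorders); BollobasRiordan2006, Ch. 7 §7.2.2 p. 169] -/
theorem yc_idx : yc T.domA T.idx = leftFaceDir h (r + 0) ∧ yc T.domQ T.idx = leftFaceDir h (r + m) ∧ yc T.domP T.idx = leftFaceDir h (r + 5) := by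
  have R := T.removableAt
  have F := finm m T.m_le
  have F5 := fin5 r
  obtain ⟨hQ, hP, hA⟩ := T.markDart_idx
  refine ⟨?_, ?_, ?_⟩
  · rw [F5.2.2.2.2.2]
    have h0 := R.out (t := 0) (by rw [F.1]; simp)
    rw [add_zero] at h0
    exact yc_eq_leftFaceDir T.domA T.idx (g := h) (j := r) hA h0
  · -- `dQ = (g, g + e_{J+1})`, `J = r + m + 4`, `g + e_J = h`
    have eJ : h + triDir (r + (m + 1)) + triDir (r + (m + 4)) = h := by
      rw [add_assoc h, show r + (m + 4) = r + (m + 1) + 3 by rw [add_assoc r, add_assoc m]; rfl, triDir_add_three, add_neg_cancel, add_zero]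
    have eJ1 : h + triDir (r + (m + 1)) + triDir (r + (m + 4) + 1) = h + triDir (r + m) := by
      rw [show r + (m + 4) + 1 = r + (m + 1) + 4 by abel, add_triDir_add_triDir_add_four, add_assoc r, F.2.2.2.2.2.1]
    have hmark : T.domQ.markDart T.idx = (h + triDir (r + (m + 1)), h + triDir (r + (m + 1)) + triDir (r + (m + 4) + 1)) := by rw [hQ, eJ1]; rfl
    rw [yc_eq_leftFaceDir T.domQ T.idx hmark (by rw [eJ]; exact T.not_mem), show r + (m + 4) = r + m + 4 by rw [add_assoc], show r + (m + 1) = r + m + 1 by rw [add_assoc]]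
    exact leftFaceDir_contactQ h (r + m)
  · -- `dP = (g, g + e_{(r+1)+1})`, `g = h + e_{r+5}`, `g + e_{r+1} = h + e_r`
    have e2 : h + triDir (r + 5) + triDir (r + 1 + 1) = h := by
      rw [F5.2.2.2.2.1, add_assoc h, ← F5.2.2.1, triDir_add_three, add_neg_cancel, add_zero]
    have e1 : h + triDir (r + 5) + triDir (r + 1) = h + triDir r := by
      rw [add_assoc h, ← F5.2.1, triDir_add_triDir_add_two, F5.1]
    have h0 : h + triDir r ∉ D₀.verts := by have := T.out 0 (Fin.zero_le _); rwa [add_zero] at this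
    have hmark : T.domP.markDart T.idx = (h + triDir (r + 5), h + triDir (r + 5) + triDir (r + 1 + 1)) := by rw [hP, e2]; rfl
    rw [yc_eq_leftFaceDir T.domP T.idx hmark (by rw [e1]; exact h0), ← F5.2.1]
    exact leftFaceDir_add_triDir h (r + 5)

/-! ## §4 The slide datum and the identity -/

/-- ★★★ **THE CONSTRUCTED DOMAINS FORM A `SlideData`** (slid mark at `a = N_0`, i.e. `k₀ = 0`). [cite: KhristoforovSmirnov2021, §1.2 (arXiv v1 p. 2); BollobasRiordan2006, Ch. 7 §7.2.2 pp. 168–169] -/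
theorem slideData : SlideData T.domA T.domQ T.domP h r m 0 T.idx where
  verts' := T.verts'
  verts₂ := rfl
  not_mem := T.not_mem
  out := T.out
  inside := T.inside
  m_le := by have := T.m_le; omega
  k₀_lt := by rw [Fin.lt_def]; have := T.one_le; simp; omega
  yc' := fun i hi => (T.yc_of_ne hi).1
  yc₂ := fun i hi => (T.yc_of_ne hi).2
  yc'_i₀ := T.yc_idx.1
  yc₁_i₀ := T.yc_idx.2.1
  yc₂_i₀ := T.yc_idx.2.2

/-- ★★★ **THE SLIDE IDENTITY FOR THE PATTERN COUNTS OF THE CONSTRUCTED DOMAINS**, at every `H_G`-edge. [cite: KhristoforovSmirnov2021, §1.2 (arXiv v1 p. 2: the law of the link pattern), §2 Definition 3 (p. 4)] -/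
theorem patternCount_eq_add {v : HexVertex} {i : Fin 3} (hz : side v i ∈ hBonds T.domQ) (p : Pat (#S₀ + 1)) :
    patternCount T.domA v i p = patternCount T.domQ v i p + patternCount T.domP v i p :=
  T.slideData.patternCount_eq_add hz p

/-- the first mark sits at a positive position (the base `bz` is not a mark). [cite: BollobasRiordan2006, Ch. 7 §7.2.2 p. 169; lane plumbing] -/
theorem dartPos_zero_pos :
    0 < (D₀.rebase₀ T.bz_mem).dartPos (insert (slideQ h r m) S₀) ((D₀.rebase₀ T.bz_mem).card_visitTimes_of_markable _ T.card_insert₃.1 T.markable₃.1) ⟨0, Nat.succ_pos _⟩ ∧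
    0 < (D₀.rebase₀ T.bz_mem).dartPos (insert (slideP h r) S₀) ((D₀.rebase₀ T.bz_mem).card_visitTimes_of_markable _ T.card_insert₃.2.1 T.markable₃.2.1) ⟨0, Nat.succ_pos _⟩ ∧
    0 < (D₀'.rebase₀ T.bz_mem'.1).dartPos (insert (slideA h r) S₀) ((D₀'.rebase₀ T.bz_mem'.1).card_visitTimes_of_markable _ T.card_insert₃.2.2 T.markable₃.2.2)
      ⟨0, Nat.succ_pos _⟩ := by
  -- position `0` is the base `bz`, which is not a marked dart
  have key : ∀ (E : TriMarkedDomain 0) (hb : E.base = bz) (S : Finset (Site 2 × Site 2)) (hc : #S = #S₀ + 1) (hS : ∀ d ∈ S, IsMarkable E.verts d)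
      (hi : Set.InjOn Prod.fst (S : Set (Site 2 × Site 2))) (hbz : bz ∉ S), 0 < E.dartPos S (E.card_visitTimes_of_markable _ hc hS) ⟨0, Nat.succ_pos _⟩ := by
    intro E hb S hc hS hi hbz
    rw [← E.dpos_ofDarts_markDart (Nat.succ_pos _) S hc hS hi]
    by_contra h0
    have e : E.dpos ((E.ofDarts (Nat.succ_pos _) S hc hS hi).markDart ⟨0, Nat.succ_pos _⟩) = 0 := by omega
    have hm := E.ofDarts_markDart_mem (Nat.succ_pos _) S hc hS hi ⟨0, Nat.succ_pos _⟩
    have := E.iter_dpos (hS _ hm).mem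
    rw [e, triBdryIter_zero, hb] at this
    exact hbz (this ▸ hm)
  refine ⟨key _ rfl _ T.card_insert₃.1 T.markable₃.1 T.injOn₃.1 ?_, key _ rfl _ T.card_insert₃.2.1 T.markable₃.2.1 T.injOn₃.2.1 ?_,
    key _ rfl _ T.card_insert₃.2.2 T.markable₃.2.2 T.injOn₃.2.2 ?_⟩ <;>
    rw [Finset.mem_insert, not_or]
  · exact ⟨T.bz_ne, T.bz_not_mem⟩
  · exact ⟨fun e => T.bz_snd (by rw [e]; rfl), T.bz_not_mem⟩
  · exact ⟨fun e => T.bz_mem'.2 (by rw [e]; rfl), T.bz_not_mem⟩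

/-- ★ **the observed dart lies on the HOME stretch of all three domains** (it is their base of numbering, before the first mark). [cite: KhristoforovSmirnov2021, §2 eq. (4) and Remark 6 (arXiv v1 p. 5: `z` on a boundary arc); BollobasRiordan2006, Ch. 7 §7.2.2 p. 169] -/
theorem bz_mem_stretch : bz ∈ T.domQ.stretch (Fin.last (#S₀)) ∧ bz ∈ T.domP.stretch (Fin.last (#S₀)) ∧ bz ∈ T.domA.stretch (Fin.last (#S₀)) := by
  obtain ⟨h1, h2, h3⟩ := T.dartPos_zero_pos
  have hl : ¬ (Fin.last (#S₀)).val + 1 < #S₀ + 1 := by simp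
  refine ⟨?_, ?_, ?_⟩
  · rw [domQ, mem_stretch_ofDarts_last_iff _ _ _ _ _ _ _ hl]
    exact ⟨T.bz_mem, Or.inr (by rw [show (D₀.rebase₀ T.bz_mem).dpos bz = 0 from (D₀.rebase₀ T.bz_mem).dpos_eq_of_iter_eq (D₀.rebase₀ T.bz_mem).isTriDisc.card_pos rfl]; exact h1)⟩
  · rw [domP, mem_stretch_ofDarts_last_iff _ _ _ _ _ _ _ hl]
    exact ⟨T.bz_mem, Or.inr (by rw [show (D₀.rebase₀ T.bz_mem).dpos bz = 0 from (D₀.rebase₀ T.bz_mem).dpos_eq_of_iter_eq (D₀.rebase₀ T.bz_mem).isTriDisc.card_pos rfl]; exact h2)⟩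
  · rw [domA, mem_stretch_ofDarts_last_iff _ _ _ _ _ _ _ hl]
    exact ⟨T.bz_mem'.1, Or.inr (by
      rw [show (D₀'.rebase₀ T.bz_mem'.1).dpos bz = 0 from (D₀'.rebase₀ T.bz_mem'.1).dpos_eq_of_iter_eq (D₀'.rebase₀ T.bz_mem'.1).isTriDisc.card_pos rfl]; exact h3)⟩

/-- **the observed mid-edge in `D₁`.** [cite: KhristoforovSmirnov2021, §2 eq. (4) and Remark 6 (arXiv v1 p. 5)] -/
def arcPointQ : ArcPoint T.domQ (Fin.last (#S₀)) :=
  ArcPoint.ofFlatDart (g := bz.1) (o := bz.2) T.bz_mem_stretch.1 T.flat.1 T.flat.2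

/-- **the observed mid-edge in `D₂`.** [cite: KhristoforovSmirnov2021, §2 eq. (4) and Remark 6 (arXiv v1 p. 5)] -/
def arcPointP : ArcPoint T.domP (Fin.last (#S₀)) :=
  ArcPoint.ofFlatDart (g := bz.1) (o := bz.2) T.bz_mem_stretch.2.1 T.flat.1 T.flat.2

/-- **the observed mid-edge in `D'`.** [cite: KhristoforovSmirnov2021, §2 eq. (4) and Remark 6 (arXiv v1 p. 5)] -/
def arcPointA : ArcPoint T.domA (Fin.last (#S₀)) :=
  ArcPoint.ofFlatDart (g := bz.1) (o := bz.2) T.bz_mem_stretch.2.2 (by rw [(T.verts₃).2.2, T.verts']; exact Finset.mem_insert_of_mem T.flat.1)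
    (by rw [(T.verts₃).2.2, T.verts']; exact Finset.mem_insert_of_mem T.flat.2)

/-- the three mid-edges are read at the same face and side. [cite: KhristoforovSmirnov2021, §2 eq. (4) (arXiv v1 p. 5); lane plumbing] -/
theorem arcPoint_v_i : T.arcPointA.v = T.arcPointQ.v ∧ T.arcPointA.i = T.arcPointQ.i ∧ T.arcPointP.v = T.arcPointQ.v ∧ T.arcPointP.i = T.arcPointQ.i := by
  have hvA : T.arcPointA.v = T.arcPointQ.v := by unfold arcPointA arcPointQ; rw [ArcPoint.ofFlatDart_v, ArcPoint.ofFlatDart_v]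
  have hvP : T.arcPointP.v = T.arcPointQ.v := by unfold arcPointP arcPointQ; rw [ArcPoint.ofFlatDart_v, ArcPoint.ofFlatDart_v]
  have hsQ : side T.arcPointQ.v T.arcPointQ.i = s(bz.1, bz.2) := by unfold arcPointQ; exact ArcPoint.side_ofFlatDart _ _ _
  have hsP : side T.arcPointP.v T.arcPointP.i = s(bz.1, bz.2) := by unfold arcPointP; exact ArcPoint.side_ofFlatDart _ _ _
  have hsA : side T.arcPointA.v T.arcPointA.i = s(bz.1, bz.2) := by unfold arcPointA; exact ArcPoint.side_ofFlatDart _ _ _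
  refine ⟨hvA, ?_, hvP, ?_⟩
  · apply side_injective T.arcPointQ.v
    rw [← hvA, hsA, hvA, hsQ]
  · apply side_injective T.arcPointQ.v
    rw [← hvP, hsP, hvP, hsQ]

/-- ★★★ **THE SLIDE IDENTITY, CONSTRUCTED**: `lawLP z(Ω ∪ h; M − q + a) = lawLP z(Ω; M) + lawLP z(Ω; M − q + p)` in the planar Temperley–Lieb module — for ANY unmarked discrete
domains `Ω ⊂ Ω ∪ h` with `h` attached along a contact arc of 2–4 cells (first contact end a simple corner), any common marks `S₀` (markable in both, off the contact ends' cells) and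
any flat common observed dart off the marks (HOME `FINDING-BSPAN-SLIDE-INDUCTION.md` §2 SLIDE / §4 (G2), now a theorem about constructed lawpoints).
[cite: KhristoforovSmirnov2021, §1.2 (arXiv v1 p. 2: the law of the link pattern), §2 Definition 3 and Remark 6 (pp. 4–5); PearceRittenbergDeGierNienhuis2002, §2; BollobasRiordan2006, Ch. 7 §7.2.2 pp. 168–169] -/
theorem lawLP_eq_add : lawLP T.arcPointA = lawLP T.arcPointQ + lawLP T.arcPointP :=
  T.slideData.lawLP_eq_add T.arcPointA T.arcPointQ T.arcPointP T.arcPoint_v_i.1 T.arcPoint_v_i.2.1 T.arcPoint_v_i.2.2.1 T.arcPoint_v_i.2.2.2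

end SlideDarts

end Literature.Probability.Percolation.MarkedLoops
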